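import Summits.CriticalPhenomena.PercolationContinuityZ3.Theorems.SahiIsingConditioning
import Mathlib.Probability.Martingale.Convergence

/-!
# Increasing functionals of a box-TP₂ spin law are a.e. limits of LOCAL increasing functions
# (martingale approximation with monotone versions of the window conditional expectations)

Support file of the Sahi cell (`prim-sahi`, typer seat, generation 15; `--supports stmt-CriticalPhenomena-4575`).
Theorems only (no definitions, no named facts, no sorries).

Generation 13 proved Sahi's Theorem 2 with two free slots for box-TP₂ laws on `{−1,+1}^ι` when ALL slots are
LOCAL (`msahiE_nonneg_offTwo_of_isBoxTP2_local`): the window marginal is an FKG weight and the finite theorem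
applies.  A measurable increasing event of the infinite configuration (e.g. a tail event) is in general NOT an
inner or outer limit of local increasing events, so the free slots cannot be made non-local by monotone set
approximation.  The right approximants are the window CONDITIONAL EXPECTATIONS: by Lévy's upward theorem
(Mathlib `Integrable.tendsto_ae_condExp`) `E[f | σ_{J_N}] → f` a.e. along an exhaustion `J_N ↑ ι`, and by the
conditioning theorem of `SahiIsingConditioning.lean` (`IsBoxTP2.condReal_cylinder_mono`: window patterns
`η ≤ η'` give stochastically ordered conditional laws) the conditional expectation of an INCREASING `f` has an
everywhere increasing local version (the monotone envelope of the cylinder averages over patterns of positive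
mass).  Contents:

* `tendsto_msahiE_of_tendsto_ae` — `E_n` is continuous along uniformly bounded a.e. convergent families
  (dominated convergence of the joint moments; the tree's `tendsto_msahiE_of_tendsto` asks everywhere
  convergence).
* `condExp_ae_eq_fiberAverage` — conditional expectation given a measurable map `r` into a finite discrete space
  is a.e. the average over the fibre `r⁻¹{r ω}` (uniqueness of conditional expectation; fibres of mass zero are
  null).
* `iSup_comap_restrict_eq` — the window σ-algebras `σ(σ_{J_N})` of an exhaustion generate the product σ-algebra.
* `IsBoxTP2.exists_local_monotone_tendsto_ae` — **THE APPROXIMATION THEOREM**: for a box-TP₂ probability measure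
  `μ` on `{−1,+1}^ι` (`ι` countably infinite), an exhaustion `J_N ↑ ι` by finite windows and a measurable
  increasing `f` with `0 ≤ f ≤ B`, there are functions `g_N`, each depending only on the spins in `J_N`,
  increasing, measurable, with `0 ≤ g_N ≤ B`, and `g_N → f` `μ`-a.e.
* Consequence (companion file `SahiIsingTwoFreeSlots.lean`): Sahi's Theorem 2 with two free NON-LOCAL slots
  for every box-TP₂ law on `{−1,+1}^ι` and for the Ising states, unconditionally, every order `n`.

No sorries, no new axioms.
-/

noncomputable section

namespace Summit.CriticalPhenomena.PercolationContinuityZ3.Theorems.SahiBoxTP2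

open MeasureTheory ProbabilityTheory Set Filter Topology Function Literature.Combinatorics.Sahi2008
open Literature.Probability.LatticeModels
open scoped ENNReal

/-! ### `E_n` along a.e. bounded convergence -/

section AELimit

variable {Ω : Type*} [MeasurableSpace Ω]

/-- **`E_n` passes to uniformly bounded a.e. limits**: if measurable families `F_N`, uniformly bounded, converge
`μ`-a.e. to a measurable family `f` slot by slot, then `E_n(F_N) → E_n(f)` (dominated convergence of every joint
moment + continuity of the moment polynomial). [this work] -/
theorem tendsto_msahiE_of_tendsto_ae (μ : Measure Ω) [IsFiniteMeasure μ] {n : ℕ}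
    (F : ℕ → Fin n → Ω → ℝ) (f : Fin n → Ω → ℝ) (hFm : ∀ N i, Measurable (F N i)) {C : ℝ}
    (hFC : ∀ N i x, |F N i x| ≤ C) (hlim : ∀ i, ∀ᵐ x ∂μ, Tendsto (fun N => F N i x) atTop (𝓝 (f i x))) :
    Tendsto (fun N => msahiE μ n (F N)) atTop (𝓝 (msahiE μ n f)) := by
  have hall : ∀ᵐ x ∂μ, ∀ i, Tendsto (fun N => F N i x) atTop (𝓝 (f i x)) := ae_all_iff.2 hlim
  have hmo : ∀ S : Finset (Fin n),
      Tendsto (fun N => ∫ x, (∏ i ∈ S, F N i) x ∂μ) atTop (𝓝 (∫ x, (∏ i ∈ S, f i) x ∂μ)) := by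
    intro S
    refine tendsto_integral_of_dominated_convergence (fun _ => C ^ S.card) (fun N => ?_)
      (integrable_const _) (fun N => Eventually.of_forall fun x => ?_) ?_
    · have hm : Measurable fun x => (∏ i ∈ S, F N i) x := by
        simp only [Finset.prod_apply]
        exact Finset.measurable_prod S fun i _ => hFm N i
      exact hm.aestronglyMeasurable
    · rw [Real.norm_eq_abs, Finset.prod_apply, Finset.abs_prod]
      calc ∏ j ∈ S, |F N j x| ≤ ∏ _j ∈ S, C :=
            Finset.prod_le_prod (fun j _ => abs_nonneg _) fun j _ => hFC N j x
        _ = C ^ S.card := Finset.prod_const C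
    · filter_upwards [hall] with x hx
      simp only [Finset.prod_apply]
      exact tendsto_finsetProd S fun i _ => hx i
  have hE : (fun N => msahiE μ n (F N)) =
      (momentE n) ∘ (fun N => fun S : Finset (Fin n) => ∫ x, (∏ i ∈ S, F N i) x ∂μ) := by
    funext N
    rw [Function.comp_apply, msahiE_eq_momentE]
  rw [hE, msahiE_eq_momentE]
  exact ((continuous_momentE n).tendsto _).comp (tendsto_pi_nhds.2 hmo)

/-- **Nonnegativity of `E_n` passes to uniformly bounded a.e. limits.** [this work] -/
theorem msahiE_nonneg_of_tendsto_ae (μ : Measure Ω) [IsFiniteMeasure μ] {n : ℕ}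
    (F : ℕ → Fin n → Ω → ℝ) (f : Fin n → Ω → ℝ) (hFm : ∀ N i, Measurable (F N i)) {C : ℝ}
    (hFC : ∀ N i x, |F N i x| ≤ C) (hlim : ∀ i, ∀ᵐ x ∂μ, Tendsto (fun N => F N i x) atTop (𝓝 (f i x)))
    (hpos : ∀ N, 0 ≤ msahiE μ n (F N)) : 0 ≤ msahiE μ n f :=
  ge_of_tendsto' (tendsto_msahiE_of_tendsto_ae μ F f hFm hFC hlim) hpos

end AELimit

/-! ### Conditional expectation given a finite-valued map = fibre averages -/

section FiberAverage

variable {Ω K : Type*}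

/-- A preimage along `r` is the finite disjoint union of the fibres over its points. [folklore] -/
theorem preimage_eq_biUnion_fiber [Fintype K] (r : Ω → K) (S : Set K) [DecidablePred (· ∈ S)] :
    r ⁻¹' S = ⋃ k ∈ (Finset.univ.filter fun k => k ∈ S), r ⁻¹' {k} := by
  ext ω
  simp only [mem_preimage, mem_iUnion, Finset.mem_filter, Finset.mem_univ, true_and, mem_singleton_iff,
    exists_prop, exists_eq_right']

variable [m₀ : MeasurableSpace Ω] [MeasurableSpace K]

omit m₀ in
/-- A set measurable for the σ-algebra pulled back along `r` is a preimage. [folklore] -/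
theorem exists_preimage_eq_of_measurableSet_comap {r : Ω → K} {s : Set Ω}
    (hs : MeasurableSet[MeasurableSpace.comap r inferInstance] s) : ∃ S : Set K, r ⁻¹' S = s := by
  obtain ⟨S, -, hS⟩ := MeasurableSpace.measurableSet_comap.1 hs
  exact ⟨S, hS⟩

variable [MeasurableSingletonClass K] [Fintype K]

/-- **Conditional expectation given a map into a finite discrete space is the fibre average, a.e.**: for `μ`
finite, `r : Ω → K` measurable (`K` finite, discrete) and `f` integrable,
`μ[f | σ(r)] = (ω ↦ (μ(r⁻¹{r ω}))⁻¹ ∫_{r⁻¹{r ω}} f dμ)` almost everywhere. [folklore] -/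
theorem condExp_ae_eq_fiberAverage (μ : Measure Ω) [IsFiniteMeasure μ] {r : Ω → K} (hr : Measurable r)
    {f : Ω → ℝ} (hf : Integrable f μ) :
    μ[f | MeasurableSpace.comap r inferInstance] =ᵐ[μ]
      fun ω => (μ.real (r ⁻¹' {r ω}))⁻¹ * ∫ x in r ⁻¹' {r ω}, f x ∂μ := by
  classical
  have hm : MeasurableSpace.comap r (inferInstance : MeasurableSpace K) ≤ m₀ := hr.comap_le
  -- the fibre averages, as a function on `K`
  have hg : (fun ω => (μ.real (r ⁻¹' {r ω}))⁻¹ * ∫ x in r ⁻¹' {r ω}, f x ∂μ) =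
      (fun k => (μ.real (r ⁻¹' {k}))⁻¹ * ∫ x in r ⁻¹' {k}, f x ∂μ) ∘ r := rfl
  rw [hg]
  have hgm : Measurable[MeasurableSpace.comap r (inferInstance : MeasurableSpace K)]
      ((fun k => (μ.real (r ⁻¹' {k}))⁻¹ * ∫ x in r ⁻¹' {k}, f x ∂μ) ∘ r) :=
    (measurable_of_countable _).comp (comap_measurable r)
  have hB : ∀ k, |(μ.real (r ⁻¹' {k}))⁻¹ * ∫ x in r ⁻¹' {k}, f x ∂μ| ≤
      ∑ k', |(μ.real (r ⁻¹' {k'}))⁻¹ * ∫ x in r ⁻¹' {k'}, f x ∂μ| := fun k =>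
    Finset.single_le_sum (f := fun k' => |(μ.real (r ⁻¹' {k'}))⁻¹ * ∫ x in r ⁻¹' {k'}, f x ∂μ|)
      (fun k' _ => abs_nonneg _) (Finset.mem_univ k)
  have hgi : Integrable ((fun k => (μ.real (r ⁻¹' {k}))⁻¹ * ∫ x in r ⁻¹' {k}, f x ∂μ) ∘ r) μ :=
    Integrable.of_bound ((hgm.mono hm le_rfl).aestronglyMeasurable) _
      (Eventually.of_forall fun ω => by rw [Real.norm_eq_abs]; exact hB (r ω))
  -- fibre integrals agree
  have hfib : ∀ k : K, ∫ x in r ⁻¹' {k}, ((fun k => (μ.real (r ⁻¹' {k}))⁻¹ * ∫ x in r ⁻¹' {k}, f x ∂μ) ∘ r) x ∂μ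
      = ∫ x in r ⁻¹' {k}, f x ∂μ := by
    intro k
    have hmeas : MeasurableSet (r ⁻¹' {k}) := hr (measurableSet_singleton k)
    rw [setIntegral_congr_fun hmeas (g := fun _ => (μ.real (r ⁻¹' {k}))⁻¹ * ∫ x in r ⁻¹' {k}, f x ∂μ)
      fun x hx => by
        simp only [Function.comp_apply, mem_preimage, mem_singleton_iff] at hx ⊢
        rw [hx]]
    rw [setIntegral_const, smul_eq_mul]
    by_cases h0 : μ.real (r ⁻¹' {k}) = 0
    · have hnull : μ (r ⁻¹' {k}) = 0 := (measureReal_eq_zero_iff (measure_ne_top _ _)).1 h0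
      rw [h0, zero_mul, Measure.restrict_eq_zero.2 hnull, integral_zero_measure]
    · rw [← mul_assoc, mul_inv_cancel₀ h0, one_mul]
  symm
  refine ae_eq_condExp_of_forall_setIntegral_eq hm hf (fun s _ _ => hgi.integrableOn) (fun s hs _ => ?_)
    (hgm.stronglyMeasurable).aestronglyMeasurable
  obtain ⟨S, rfl⟩ := exists_preimage_eq_of_measurableSet_comap hs
  rw [preimage_eq_biUnion_fiber r S,
    integral_biUnion_finset _ (fun k _ => hr (measurableSet_singleton k)) ?_ (fun k _ => hgi.integrableOn),
    integral_biUnion_finset _ (fun k _ => hr (measurableSet_singleton k)) ?_ (fun k _ => hf.integrableOn)]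
  · exact Finset.sum_congr rfl fun k _ => hfib k
  all_goals exact fun k _ k' _ hkk' => disjoint_left.2 fun ω hω hω' => hkk' (hω.symm.trans hω')

end FiberAverage

/-! ### The window σ-algebras generate the product σ-algebra -/

section Windows

variable {ι : Type*} {X : Type*} [MeasurableSpace X]

/-- The window σ-algebra `σ(x_J)` (pull-back of the product σ-algebra on `X^J` along restriction).  It grows with
the window. [folklore] -/
theorem comap_restrict_mono {J J' : Finset ι} (h : J ⊆ J') :
    MeasurableSpace.comap (fun x : ι → X => J.restrict x) MeasurableSpace.pi ≤
      MeasurableSpace.comap (fun x : ι → X => J'.restrict x) MeasurableSpace.pi := by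
  have e : (fun x : ι → X => J.restrict x) =
      Finset.restrict₂ (π := fun _ : ι => X) h ∘ fun x : ι → X => J'.restrict x := rfl
  rw [e, ← MeasurableSpace.comap_comp]
  exact MeasurableSpace.comap_mono (Finset.measurable_restrict₂ (X := fun _ : ι => X) h).comap_le

/-- The window σ-algebra is a sub-σ-algebra of the product σ-algebra. [folklore] -/
theorem comap_restrict_le (J : Finset ι) :
    MeasurableSpace.comap (fun x : ι → X => J.restrict x) MeasurableSpace.pi ≤
      (MeasurableSpace.pi : MeasurableSpace (ι → X)) :=
  (Finset.measurable_restrict (X := fun _ : ι => X) J).comap_le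

/-- **The window σ-algebras of an exhaustion generate the product σ-algebra.** [folklore] -/
theorem iSup_comap_restrict_eq {J : ℕ → Finset ι} (hJ : ∀ v, ∃ N, v ∈ J N) :
    ⨆ N, MeasurableSpace.comap (fun x : ι → X => (J N).restrict x) MeasurableSpace.pi =
      (MeasurableSpace.pi : MeasurableSpace (ι → X)) := by
  refine le_antisymm (iSup_le fun N => comap_restrict_le (J N)) ?_
  refine iSup_le fun v => ?_
  obtain ⟨N, hN⟩ := hJ v
  refine le_trans ?_ (le_iSup _ N)
  have e : (fun b : ι → X => b v) = (fun y : ↥(J N) → X => y ⟨v, hN⟩) ∘ fun x : ι → X => (J N).restrict x := rfl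
  rw [e, ← MeasurableSpace.comap_comp]
  exact MeasurableSpace.comap_mono (measurable_pi_apply _).comap_le

end Windows

/-! ### Monotone local versions of the window conditional expectations of an increasing functional -/

section Spins

variable {ι : Type*} [Countable ι] [Infinite ι]

/-- **Monotone version of a window conditional expectation.**  For a box-TP₂ probability measure `μ` on
`{−1,+1}^ι`, a finite window `J` and a measurable increasing `f` with `0 ≤ f ≤ B`, there is an INCREASING
`g : {−1,+1}^J → [0, B]` with `E[f | σ_J] = g(σ_J)` a.e. — the monotone envelope
`g(η) = max {E[f | σ_J = η'] : η' ≤ η, μ(σ_J = η') > 0}` of the cylinder averages, which are increasing along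
patterns of positive mass by `IsBoxTP2.setIntegral_cylinder_mono`. [this work] -/
theorem IsBoxTP2.exists_monotone_version_condExp (μ : Measure (ι → ℤˣ)) [IsProbabilityMeasure μ]
    (hμ : IsBoxTP2 μ) (J : Finset ι) {f : (ι → ℤˣ) → ℝ} (hf : Monotone f) (hfm : Measurable f)
    (hf0 : ∀ σ, 0 ≤ f σ) {B : ℝ} (hfB : ∀ σ, f σ ≤ B) :
    ∃ g : (↥J → ℤˣ) → ℝ, Monotone g ∧ (∀ η, 0 ≤ g η) ∧ (∀ η, g η ≤ B) ∧
      μ[f | MeasurableSpace.comap (fun σ : ι → ℤˣ => J.restrict σ) MeasurableSpace.pi] =ᵐ[μ]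
        g ∘ fun σ : ι → ℤˣ => J.restrict σ := by
  classical
  set r : (ι → ℤˣ) → (↥J → ℤˣ) := fun σ => J.restrict σ with hr_def
  have hr : Measurable r := Finset.measurable_restrict (X := fun _ : ι => ℤˣ) J
  have hB0 : 0 ≤ B := (hf0 1).trans (hfB 1)
  have hfi : Integrable f μ := Integrable.of_bound hfm.aestronglyMeasurable B
    (Eventually.of_forall fun σ => by rw [Real.norm_eq_abs, abs_of_nonneg (hf0 σ)]; exact hfB σ)
  -- cylinder averages
  set avg : (↥J → ℤˣ) → ℝ := fun η => (μ.real (r ⁻¹' {η}))⁻¹ * ∫ x in r ⁻¹' {η}, f x ∂μ with havg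
  have hint0 : ∀ η, 0 ≤ ∫ x in r ⁻¹' {η}, f x ∂μ := fun η => integral_nonneg hf0
  have hintB : ∀ η, ∫ x in r ⁻¹' {η}, f x ∂μ ≤ B * μ.real (r ⁻¹' {η}) := fun η => by
    have h := setIntegral_mono_on hfi.integrableOn (integrableOn_const (hs := measure_ne_top _ _))
      (hr (measurableSet_singleton η)) fun σ _ => hfB σ
    rwa [setIntegral_const, smul_eq_mul, mul_comm] at h
  have havg0 : ∀ η, 0 ≤ avg η := fun η => mul_nonneg (inv_nonneg.2 measureReal_nonneg) (hint0 η)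
  have havgB : ∀ η, avg η ≤ B := fun η => by
    by_cases h0 : μ.real (r ⁻¹' {η}) = 0
    · simp only [havg, h0, inv_zero, zero_mul]; exact hB0
    · rw [havg]
      simp only
      rw [inv_mul_le_iff₀ (lt_of_le_of_ne measureReal_nonneg (Ne.symm h0))]
      linarith [hintB η, mul_comm B (μ.real (r ⁻¹' {η}))]
  -- monotonicity of the averages along patterns of positive mass (the conditioning theorem)
  have havgmono : ∀ {η' η}, η' ≤ η → μ (r ⁻¹' {η'}) ≠ 0 → μ (r ⁻¹' {η}) ≠ 0 → avg η' ≤ avg η := by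
    intro η' η hle h0' h0
    have key := hμ.setIntegral_cylinder_mono μ J hle hf hfm (C := B) fun σ => by
      rw [abs_of_nonneg (hf0 σ)]; exact hfB σ
    have hp' : 0 < μ.real (r ⁻¹' {η'}) := ENNReal.toReal_pos h0' (measure_ne_top _ _)
    have hp : 0 < μ.real (r ⁻¹' {η}) := ENNReal.toReal_pos h0 (measure_ne_top _ _)
    rw [havg]
    simp only
    rw [inv_mul_eq_div, inv_mul_eq_div, div_le_div_iff₀ hp' hp]
    calc (∫ x in r ⁻¹' {η'}, f x ∂μ) * μ.real (r ⁻¹' {η}) ≤ μ.real (r ⁻¹' {η'}) * ∫ x in r ⁻¹' {η}, f x ∂μ := key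
      _ = (∫ x in r ⁻¹' {η}, f x ∂μ) * μ.real (r ⁻¹' {η'}) := mul_comm _ _
  -- the monotone envelope
  let avgN : (↥J → ℤˣ) → NNReal := fun η => ⟨avg η, havg0 η⟩
  let gN : (↥J → ℤˣ) → NNReal := fun η =>
    (Finset.univ.filter fun η' => η' ≤ η ∧ μ (r ⁻¹' {η'}) ≠ 0).sup avgN
  let g : (↥J → ℤˣ) → ℝ := fun η => (gN η : ℝ)
  have hgmono : Monotone g := fun η₁ η₂ h12 => by
    refine NNReal.coe_le_coe.2 (Finset.sup_mono (Finset.monotone_filter_right _ fun η' _ h => ?_))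
    exact ⟨h.1.trans h12, h.2⟩
  have hg0 : ∀ η, 0 ≤ g η := fun η => NNReal.coe_nonneg _
  have hgB : ∀ η, g η ≤ B := fun η => by
    have h : gN η ≤ ⟨B, hB0⟩ := Finset.sup_le fun η' _ => havgB η'
    exact NNReal.coe_le_coe.2 h
  have hgeq : ∀ η, μ (r ⁻¹' {η}) ≠ 0 → g η = avg η := fun η h0 => by
    have h : gN η = avgN η := by
      refine le_antisymm (Finset.sup_le fun η' hη' => ?_)
        (Finset.le_sup (f := avgN) (Finset.mem_filter.2 ⟨Finset.mem_univ _, le_rfl, h0⟩))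
      obtain ⟨-, hle, h0'⟩ := Finset.mem_filter.1 hη'
      exact havgmono hle h0' h0
    show (gN η : ℝ) = avg η
    rw [h]
    rfl
  refine ⟨g, hgmono, hg0, hgB, (condExp_ae_eq_fiberAverage μ hr hfi).trans ?_⟩
  -- `avg ∘ r = g ∘ r` off the null cylinders
  have hnull : μ (⋃ η ∈ (Finset.univ.filter fun η => μ (r ⁻¹' {η}) = 0), r ⁻¹' {η}) = 0 := by
    refine le_antisymm ((measure_biUnion_finset_le _ _).trans ?_) zero_le
    rw [Finset.sum_eq_zero fun η hη => (Finset.mem_filter.1 hη).2]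
  rw [Filter.EventuallyEq, ae_iff]
  refine measure_mono_null (fun σ hσ => ?_) hnull
  simp only [mem_setOf_eq, Function.comp_apply] at hσ
  simp only [mem_iUnion, Finset.mem_filter, Finset.mem_univ, true_and, mem_preimage, mem_singleton_iff,
    exists_prop]
  by_contra hcon
  push Not at hcon
  exact hσ (hgeq (r σ) fun h => hcon (r σ) h rfl).symm

/-- **THE APPROXIMATION THEOREM.**  For a box-TP₂ probability measure `μ` on `{−1,+1}^ι` (`ι` countably
infinite), an exhaustion `J_N ↑ ι` by finite windows and a measurable increasing `f` with `0 ≤ f ≤ B`, there are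
LOCAL (depending only on the spins in `J_N`), INCREASING, measurable `g_N` with `0 ≤ g_N ≤ B` and `g_N → f`
`μ`-almost everywhere (`g_N` = the monotone version of `E[f | σ_{J_N}]`; Lévy's upward theorem). [this work] -/
theorem IsBoxTP2.exists_local_monotone_tendsto_ae (μ : Measure (ι → ℤˣ)) [IsProbabilityMeasure μ]
    (hμ : IsBoxTP2 μ) {J : ℕ → Finset ι} (hJm : Monotone J) (hJ : ∀ v, ∃ N, v ∈ J N)
    {f : (ι → ℤˣ) → ℝ} (hf : Monotone f) (hfm : Measurable f) (hf0 : ∀ σ, 0 ≤ f σ) {B : ℝ}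
    (hfB : ∀ σ, f σ ≤ B) :
    ∃ g : ℕ → (ι → ℤˣ) → ℝ, (∀ N, DependsOn (g N) (↑(J N) : Set ι)) ∧ (∀ N, Monotone (g N)) ∧
      (∀ N, Measurable (g N)) ∧ (∀ N σ, 0 ≤ g N σ) ∧ (∀ N σ, g N σ ≤ B) ∧
      ∀ᵐ σ ∂μ, Tendsto (fun N => g N σ) atTop (𝓝 (f σ)) := by
  choose g hgmono hg0 hgB hgae using fun N => hμ.exists_monotone_version_condExp μ (J N) hf hfm hf0 hfB
  refine ⟨fun N => g N ∘ fun σ : ι → ℤˣ => (J N).restrict σ, fun N σ τ hστ => ?_,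
    fun N σ τ hστ => hgmono N fun j => hστ j, fun N => (measurable_of_countable (g N)).comp
      (Finset.measurable_restrict (X := fun _ : ι => ℤˣ) (J N)), fun N σ => hg0 N _, fun N σ => hgB N _, ?_⟩
  · simp only [Function.comp_apply]
    congr 1
    funext j
    exact hστ j (Finset.mem_coe.2 j.2)
  -- Lévy's upward theorem along the window filtration
  let ℱ : Filtration ℕ (MeasurableSpace.pi : MeasurableSpace (ι → ℤˣ)) :=
    { seq := fun N => MeasurableSpace.comap (fun σ : ι → ℤˣ => (J N).restrict σ) MeasurableSpace.pi
      mono' := fun N M hNM => comap_restrict_mono (hJm hNM)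
      le' := fun N => comap_restrict_le (J N) }
  have hsup : (⨆ N, (ℱ N : MeasurableSpace (ι → ℤˣ))) = MeasurableSpace.pi := iSup_comap_restrict_eq hJ
  have hfi : Integrable f μ := Integrable.of_bound hfm.aestronglyMeasurable B
    (Eventually.of_forall fun σ => by rw [Real.norm_eq_abs, abs_of_nonneg (hf0 σ)]; exact hfB σ)
  have hsm : StronglyMeasurable[⨆ N, (ℱ N : MeasurableSpace (ι → ℤˣ))] f := by
    rw [hsup]; exact hfm.stronglyMeasurable
  have hlevy := hfi.tendsto_ae_condExp (ℱ := ℱ) hsm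
  have hall : ∀ᵐ σ ∂μ, ∀ N, (μ[f | ℱ N]) σ = (g N ∘ fun σ : ι → ℤˣ => (J N).restrict σ) σ :=
    ae_all_iff.2 fun N => hgae N
  filter_upwards [hlevy, hall] with σ hσ hσN
  exact hσ.congr fun N => hσN N

end Spins

end Summit.CriticalPhenomena.PercolationContinuityZ3.Theorems.SahiBoxTP2
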